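import Summits.BirchSwinnertonDyer.BirchSwinnertonDyer.Theorems.RamifiedSevenEllipticUnitsRigidityDirichlet
import Mathlib.NumberTheory.LSeries.Injectivity
import HarnessLib

set_option linter.dupNamespace false
set_option autoImplicit false

/-!
# Rigidity bridge (R2, first half): equal Hecke `L`-functions have equal (weighted) Dirichlet
# coefficients

Helper file for the K7r Value crux `EllipticUnitValueSevenOfGZK` (stmt-BirchSwinnertonDyer-19945), line
`rubin-formula-zp` v4.1, registered stub H_Rig `stub_pinnedCharacterStructureSeven`. Step (R2) of the cell's
plan: two Hecke characters `φ`, `ψ` whose `L`-functions agree on a right half-plane (both L-pinned to the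
same curve) have the SAME weighted coefficient functions `n ↦ (Σ_{N𝔞 = n} φ₀(𝔞))·n^{−σ_φ}` and
`n ↦ (Σ_{N𝔞 = n} ψ₀(𝔞))·n^{−σ_ψ}` (`φ = φ₀‖·‖^{σ_φ}`, `ψ = ψ₀‖·‖^{σ_ψ}` Weil's decompositions): file (R1)
(`…RigidityDirichlet`) writes each side as a translated Dirichlet series, this file un-translates
(`LSeries.term_shift`: `term (a·n^{−σ}) s = term a (s + σ)`) and applies Mathlib's injectivity of the
`L`-series transform (`LSeries.eq_of_LSeries_eventually_eq`; abscissas are finite by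
`LSeriesSummable_twistCount`). RESULT `weightedCoeff_eq_of_heckeLFunction_eq`. The per-prime reading
(ideals of norm `ℓ`, `ℓ²` in a quadratic field ⇒ value pairs) is step (R2, second half).

References: Neukirch, *Algebraic Number Theory*, VII (8.1); Weil, *Basic Number Theory*, VII §3, §7.
-/

noncomputable section

open scoped Classical
open Filter NumberField IsDedekindDomain
  Literature.NumberTheory.GaloisRepresentations
  Literature.NumberTheory.LFunctions

namespace Summit.BirchSwinnertonDyer.BirchSwinnertonDyer.Theorems.RamifiedSevenEllipticUnits

namespace Rigidity

/-! ## §1 Translating a Dirichlet series -/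

/-- **`term (n ↦ a n · n^{−σ}) s = term a (s + σ)`**: translating the variable is weighting the
coefficients. [folklore] -/
theorem term_shift (a : ℕ → ℂ) (σ : ℝ) (s : ℂ) :
    LSeries.term (fun n ↦ a n * (n : ℂ) ^ (-(σ : ℂ))) s = LSeries.term a (s + σ) := by
  funext n
  rcases eq_or_ne n 0 with rfl | hn
  · simp
  · have hn' : (n : ℂ) ≠ 0 := by exact_mod_cast hn
    rw [LSeries.term_of_ne_zero hn, LSeries.term_of_ne_zero hn, Complex.cpow_add _ _ hn',
      Complex.cpow_neg]
    field_simp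

/-- `LSeries (n ↦ a n · n^{−σ}) s = LSeries a (s + σ)`. [folklore] -/
theorem LSeries_shift (a : ℕ → ℂ) (σ : ℝ) (s : ℂ) :
    LSeries (fun n ↦ a n * (n : ℂ) ^ (-(σ : ℂ))) s = LSeries a (s + σ) := by
  rw [LSeries, LSeries, term_shift]

/-- `LSeriesSummable (n ↦ a n · n^{−σ}) s ↔ LSeriesSummable a (s + σ)`. [folklore] -/
theorem LSeriesSummable_shift_iff (a : ℕ → ℂ) (σ : ℝ) (s : ℂ) :
    LSeriesSummable (fun n ↦ a n * (n : ℂ) ^ (-(σ : ℂ))) s ↔ LSeriesSummable a (s + σ) := by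
  rw [LSeriesSummable, LSeriesSummable, term_shift]

/-! ## §2 Equal Hecke `L`-functions ⇒ equal weighted coefficients -/

variable {K : Type} [Field K] [NumberField K]

/-- The coefficient function of a unitary character has finite abscissa of absolute convergence
after any translation (it converges for `re s > 1`). [cite: NeukirchANT1999, Ch. VII §8 (8.1)] -/
theorem abscissaOfAbsConv_weighted_lt_top {χ₀ : HeckeCharacter K} (hu : χ₀.IsUnitary)
    {𝔪 : Ideal (𝓞 K)} (h𝔪 : 𝔪 ≠ ⊥) (σ : ℝ) :
    LSeries.abscissaOfAbsConv (fun n ↦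
      NumberField.twistCount K (rayClassCoeffHom 𝔪 fun v ↦ χ₀.valueAtUniformizer v) n *
        (n : ℂ) ^ (-(σ : ℂ))) < ⊤ := by
  have hν : ∀ I, ‖rayClassCoeffHom 𝔪 (fun v ↦ χ₀.valueAtUniformizer v) I‖ ≤ 1 :=
    norm_rayClassCoeffHom_le h𝔪 fun v _ ↦ (HeckeCharacter.norm_valueAtUniformizer_of_isUnitary hu v).le
  have hsum : LSeriesSummable (fun n ↦
      NumberField.twistCount K (rayClassCoeffHom 𝔪 fun v ↦ χ₀.valueAtUniformizer v) n *
        (n : ℂ) ^ (-(σ : ℂ))) ((2 - σ : ℝ) : ℂ) := by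
    rw [LSeriesSummable_shift_iff]
    refine NumberField.LSeriesSummable_twistCount hν ?_
    simp only [Complex.add_re, Complex.ofReal_re]
    linarith
  exact lt_of_le_of_lt (hsum.abscissaOfAbsConv_le) (EReal.coe_lt_top _)

/-- **Equal Hecke `L`-functions have equal weighted Dirichlet coefficients.** If
`heckeLFunction φ s = heckeLFunction ψ s` for `re s > s₀`, then with Weil's decompositions
`φ = φ₀‖·‖^{σ₁}`, `ψ = ψ₀‖·‖^{σ₂}` (file (R1)) the coefficient functions satisfy, for every `n ≠ 0`,
`(Σ_{N𝔞 = n} φ₀(𝔞))·n^{−σ₁} = (Σ_{N𝔞 = n} ψ₀(𝔞))·n^{−σ₂}` (sums over ideals prime to the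
respective ramification moduli). [cite: NeukirchANT1999, Ch. VII §8 (8.1)] [cite: WeilBNT1967, Ch. VII §7 ¶1] -/
theorem weightedCoeff_eq_of_heckeLFunction_eq (φ ψ : HeckeCharacter K) (s₀ : ℝ)
    (h : ∀ s : ℂ, s₀ < s.re → heckeLFunction φ s = heckeLFunction ψ s) :
    ∃ (σ₁ : ℝ) (φ₀ : HeckeCharacter K) (𝔪₁ : Ideal (𝓞 K)) (σ₂ : ℝ) (ψ₀ : HeckeCharacter K)
      (𝔪₂ : Ideal (𝓞 K)),
      φ₀.IsUnitary ∧ 𝔪₁ ≠ ⊥ ∧ (∀ x : ideleGroup K, ‖((φ x : ℂˣ) : ℂ)‖ = ideleNorm x ^ σ₁) ∧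
      (∀ v : HeightOneSpectrum (𝓞 K), φ.IsUnramifiedAt v ↔ ¬ 𝔪₁ ≤ v.asIdeal) ∧
      (∀ v : HeightOneSpectrum (𝓞 K), φ₀.IsUnramifiedAt v ↔ ¬ 𝔪₁ ≤ v.asIdeal) ∧
      (∀ v : HeightOneSpectrum (𝓞 K), φ₀.valueAtUniformizer v =
        φ.valueAtUniformizer v * ((Ideal.absNorm v.asIdeal : ℕ) : ℂ) ^ (σ₁ : ℂ)) ∧
      ψ₀.IsUnitary ∧ 𝔪₂ ≠ ⊥ ∧ (∀ x : ideleGroup K, ‖((ψ x : ℂˣ) : ℂ)‖ = ideleNorm x ^ σ₂) ∧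
      (∀ v : HeightOneSpectrum (𝓞 K), ψ.IsUnramifiedAt v ↔ ¬ 𝔪₂ ≤ v.asIdeal) ∧
      (∀ v : HeightOneSpectrum (𝓞 K), ψ₀.IsUnramifiedAt v ↔ ¬ 𝔪₂ ≤ v.asIdeal) ∧
      (∀ v : HeightOneSpectrum (𝓞 K), ψ₀.valueAtUniformizer v =
        ψ.valueAtUniformizer v * ((Ideal.absNorm v.asIdeal : ℕ) : ℂ) ^ (σ₂ : ℂ)) ∧
      ∀ n : ℕ, n ≠ 0 →
        NumberField.twistCount K (rayClassCoeffHom 𝔪₁ fun v ↦ φ₀.valueAtUniformizer v) n *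
            (n : ℂ) ^ (-(σ₁ : ℂ)) =
          NumberField.twistCount K (rayClassCoeffHom 𝔪₂ fun v ↦ ψ₀.valueAtUniformizer v) n *
            (n : ℂ) ^ (-(σ₂ : ℂ)) := by
  obtain ⟨σ₁, φ₀, 𝔪₁, hu₁, h𝔪₁, hσ₁, hiff₁, hiff₁', hval₁, hL₁⟩ :=
    exists_heckeLFunction_eq_LSeries_translate φ
  obtain ⟨σ₂, ψ₀, 𝔪₂, hu₂, h𝔪₂, hσ₂, hiff₂, hiff₂', hval₂, hL₂⟩ :=
    exists_heckeLFunction_eq_LSeries_translate ψ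
  refine ⟨σ₁, φ₀, 𝔪₁, σ₂, ψ₀, 𝔪₂, hu₁, h𝔪₁, hσ₁, hiff₁, hiff₁', hval₁, hu₂, h𝔪₂, hσ₂, hiff₂, hiff₂',
    hval₂, fun n hn ↦ ?_⟩
  refine LSeries.eq_of_LSeries_eventually_eq (abscissaOfAbsConv_weighted_lt_top hu₁ h𝔪₁ σ₁)
    (abscissaOfAbsConv_weighted_lt_top hu₂ h𝔪₂ σ₂) ?_ hn
  -- on large reals both weighted series ARE the common `L`-function
  rw [Filter.EventuallyEq, Filter.eventually_atTop]
  refine ⟨max s₀ (max (1 - σ₁) (1 - σ₂)) + 1, fun x hx ↦ ?_⟩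
  have hx₀ : s₀ < ((x : ℂ)).re := by simp only [Complex.ofReal_re]; linarith [le_max_left s₀ (max (1 - σ₁) (1 - σ₂))]
  have hx₁ : 1 - σ₁ < ((x : ℂ)).re := by
    simp only [Complex.ofReal_re]
    linarith [le_max_left (1 - σ₁) (1 - σ₂), le_max_right s₀ (max (1 - σ₁) (1 - σ₂))]
  have hx₂ : 1 - σ₂ < ((x : ℂ)).re := by
    simp only [Complex.ofReal_re]
    linarith [le_max_right (1 - σ₁) (1 - σ₂), le_max_right s₀ (max (1 - σ₁) (1 - σ₂))]
  show LSeries _ (x : ℂ) = LSeries _ (x : ℂ)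
  rw [LSeries_shift, LSeries_shift, ← hL₁ x hx₁, ← hL₂ x hx₂]
  exact h x hx₀

end Rigidity

end Summit.BirchSwinnertonDyer.BirchSwinnertonDyer.Theorems.RamifiedSevenEllipticUnits

end
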